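import Mathlib
import HarnessLib

/-!
# Algebra homomorphisms `M_n(K) → M_n(L)` are conjugate to the entrywise scalar extension
# (the Skolem–Noether theorem for matrix algebras, elementary case)

Topic `LinearAlgebra/Matrix`; theorems only (no definition, no named fact, no instance). For fields
`K ⊆ L` (any `[Algebra K L]`), a finite index type `ι` and a `K`-algebra homomorphism
`φ : M_ι(K) →ₐ[K] M_ι(L)`, there is `g ∈ GL_ι(L)` with

  `φ(x) = g · x^L · g⁻¹` for all `x`, `x^L = x.map (algebraMap K L)`

(`exists_algHom_apply_eq_conj`). This is the special case of the Skolem–Noether theorem that the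
arithmetic of Shimura curves needs (a real splitting `ι : B → M₂(ℝ)` of `B ≅ M₂(ℚ)` is
`GL₂(ℝ)`-conjugate to the inclusion `M₂(ℚ) ⊆ M₂(ℝ)`; brick "S2" of the proof of
`Literature.NumberTheory.Automorphic.ShimuraCurveData.volume_fd_eq` for `D = 1`), with the
classical elementary proof by matrix units: the images `f_{ij} = φ(E_{ij})` satisfy
`f_{ij} f_{kl} = δ_{jk} f_{il}`, `Σ f_{ii} = 1`, so `f_{i₀i₀} ≠ 0`; for `u ≠ 0` in the range of the
idempotent `f_{i₀i₀}` the vectors `c_j = f_{j i₀} u` are linearly independent (apply `f_{i₀ k}`) and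
the matrix `g` with columns `c_j` satisfies `f_{kl} g = g E_{kl}`, hence `φ(x) g = g x^L` by
linearity. Mathlib (pinned) has no Skolem–Noether theorem (`rg Skolem` finds only model theory);
the tree proves other special cases inline (`QuaternionAlgebraHasse`: an explicit conjugator for a
quadratic subfield).

## References

* Folklore; e.g. P. Gille, T. Szamuely, *Central Simple Algebras and Galois Cohomology* (2006),
  Thm. 2.7.2 (Skolem–Noether); M.-F. Vignéras, LNM 800, Ch. I §2 Thm. 2.1.
-/

open Matrix

namespace Literature.LinearAlgebra.Matrix

variable {K L ι : Type*} [Field K] [Field L] [Algebra K L] [Fintype ι] [DecidableEq ι]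

/-- The images of the matrix units under an algebra homomorphism multiply like matrix units:
`φ(E_{ij}) φ(E_{kl}) = δ_{jk} φ(E_{il})`. [folklore] -/
theorem algHom_single_mul_single (φ : Matrix ι ι K →ₐ[K] Matrix ι ι L) (i j k l : ι) :
    φ (single i j 1) * φ (single k l 1) = if j = k then φ (single i l 1) else 0 := by
  rw [← map_mul]
  split_ifs with h
  · subst h
    rw [single_mul_single_same, mul_one]
  · rw [single_mul_single_of_ne (c := (1 : K)) i j k h (1 : K), map_zero]

/-- `Σ_i E_{ii} = 1`. [folklore] -/
theorem sum_single_diag_one : ∑ i : ι, single i i (1 : K) = 1 := by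
  ext a b
  simp only [Matrix.sum_apply, single, of_apply, one_apply]
  by_cases hab : a = b
  · subst hab
    simp
  · rw [if_neg hab]
    refine Finset.sum_eq_zero fun i _ => ?_
    rw [if_neg]
    rintro ⟨rfl, rfl⟩
    exact hab rfl

/-- **Skolem–Noether for matrix algebras (elementary form).** Every `K`-algebra homomorphism
`φ : M_ι(K) → M_ι(L)`, `L` a field extension of `K` (any `K`-algebra that is a field), is conjugate
by some `g ∈ GL_ι(L)` to the entrywise map: `φ(x) = g · x.map (algebraMap K L) · g⁻¹`.
[folklore] -/
theorem exists_algHom_apply_eq_conj (φ : Matrix ι ι K →ₐ[K] Matrix ι ι L) :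
    ∃ g : GL ι L, ∀ x : Matrix ι ι K,
      φ x = (g : Matrix ι ι L) * x.map (algebraMap K L) * ((g⁻¹ : GL ι L) : Matrix ι ι L) := by
  classical
  rcases isEmpty_or_nonempty ι with hι | ⟨⟨i₀⟩⟩
  · exact ⟨1, fun x => Subsingleton.elim _ _⟩
  haveI : Nonempty ι := ⟨i₀⟩
  -- the images of the matrix units
  set f : ι → ι → Matrix ι ι L := fun i j => φ (single i j 1) with hf
  have hmul : ∀ i j k l, f i j * f k l = if j = k then f i l else 0 :=
    fun i j k l => algHom_single_mul_single φ i j k l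
  have hsum : ∑ i, f i i = 1 := by
    simp only [hf]
    rw [← map_sum, sum_single_diag_one, map_one]
  have h00 : f i₀ i₀ ≠ 0 := by
    intro h0
    have hdiag : ∀ j, f j j = 0 := fun j => by
      calc f j j = f j i₀ * f i₀ j := by rw [hmul, if_pos rfl]
        _ = f j i₀ * (f i₀ i₀ * f i₀ j) := by rw [hmul i₀ i₀ i₀ j, if_pos rfl]
        _ = 0 := by rw [h0, zero_mul, mul_zero]
    have h10 : (1 : Matrix ι ι L) = 0 := by
      rw [← hsum]
      exact Finset.sum_eq_zero fun j _ => hdiag j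
    exact one_ne_zero h10
  -- a vector `u ≠ 0` with `f_{i₀i₀} u = u`
  obtain ⟨w, hw⟩ : ∃ w : ι → L, f i₀ i₀ *ᵥ w ≠ 0 := by
    by_contra hall
    simp only [not_exists, not_not] at hall
    apply h00
    ext a b
    have := congrFun (hall (Pi.single b 1)) a
    rw [mulVec_single_one] at this
    simpa [col_apply] using this
  set u : ι → L := f i₀ i₀ *ᵥ w with hu
  have hu0 : u ≠ 0 := hw
  have hfu : f i₀ i₀ *ᵥ u = u := by
    rw [hu, mulVec_mulVec, hmul, if_pos rfl]
  have hfc : ∀ k l j, f k l *ᵥ (f j i₀ *ᵥ u) = if l = j then f k i₀ *ᵥ u else 0 := by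
    intro k l j
    rw [mulVec_mulVec, hmul]
    split_ifs
    · rfl
    · exact zero_mulVec _
  -- the conjugating matrix, with columns `c_j = f_{j i₀} u`
  set g₀ : Matrix ι ι L := Matrix.of fun a j => (f j i₀ *ᵥ u) a with hg₀
  have hcol : ∀ j, g₀.col j = f j i₀ *ᵥ u := fun j => by
    ext a
    simp [hg₀, col_apply]
  -- `f_{kl} g₀ = g₀ E_{kl}`
  have hkey : ∀ k l, f k l * g₀ = g₀ * single k l 1 := by
    intro k l
    ext a j
    have lhs : (f k l * g₀) a j = (f k l *ᵥ (f j i₀ *ᵥ u)) a := by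
      simp only [mul_apply, mulVec, dotProduct, hg₀, of_apply]
    rw [lhs, hfc]
    by_cases hlj : l = j
    · subst hlj
      rw [if_pos rfl, mul_single_apply_same, mul_one]
      simp [hg₀]
    · rw [if_neg hlj, mul_single_apply_of_ne (c := (1 : L)) k l a j (Ne.symm hlj)]
      rfl
  -- `g₀` is invertible: its columns are linearly independent
  have hli : LinearIndependent L g₀.col := by
    rw [Fintype.linearIndependent_iff]
    intro a ha k
    have h1 : f i₀ k *ᵥ (∑ j, a j • g₀.col j) = a k • u := by
      have e1 : f i₀ k *ᵥ (∑ j, a j • g₀.col j) = ∑ j, a j • (f i₀ k *ᵥ g₀.col j) := by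
        rw [← mulVecLin_apply, map_sum]
        refine Finset.sum_congr rfl fun j _ => ?_
        rw [map_smul, mulVecLin_apply]
      rw [e1]
      have e2 : ∀ j, a j • (f i₀ k *ᵥ g₀.col j) = if k = j then a k • u else 0 := by
        intro j
        rw [hcol, hfc, hfu]
        split_ifs with h
        · subst h; rfl
        · rw [smul_zero]
      rw [Finset.sum_congr rfl fun j _ => e2 j, Finset.sum_ite_eq]
      simp
    rw [ha, mulVec_zero] at h1
    exact (smul_eq_zero.mp h1.symm).resolve_right hu0
  have hunit : IsUnit g₀ := linearIndependent_cols_iff_isUnit.mp hli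
  refine ⟨hunit.unit, fun x => ?_⟩
  -- extend `f_{kl} g₀ = g₀ E_{kl}` to all `x` by `K`-linearity
  have hlin : (LinearMap.mulRight K g₀) ∘ₗ φ.toLinearMap =
      (LinearMap.mulLeft K g₀) ∘ₗ
        ((Algebra.ofId K L).mapMatrix : Matrix ι ι K →ₐ[K] Matrix ι ι L).toLinearMap := by
    refine (Matrix.stdBasis K ι ι).ext fun kl => ?_
    obtain ⟨k, l⟩ := kl
    simp only [LinearMap.comp_apply, AlgHom.toLinearMap_apply, LinearMap.mulRight_apply,
      LinearMap.mulLeft_apply, Matrix.stdBasis_eq_single, AlgHom.mapMatrix_apply, map_single,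
      map_one]
    exact hkey k l
  have hx : φ x * g₀ = g₀ * x.map (algebraMap K L) := by
    have := congrArg (fun T => T x) hlin
    have e : (⇑(Algebra.ofId K L) : K → L) = ⇑(algebraMap K L) := rfl
    simpa only [LinearMap.comp_apply, AlgHom.toLinearMap_apply, LinearMap.mulRight_apply,
      LinearMap.mulLeft_apply, AlgHom.mapMatrix_apply, e] using this
  have hg : (hunit.unit : Matrix ι ι L) = g₀ := hunit.unit_spec
  calc φ x = φ x * ((hunit.unit : Matrix ι ι L) *
        ((hunit.unit⁻¹ : (Matrix ι ι L)ˣ) : Matrix ι ι L)) := by rw [Units.mul_inv, mul_one]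
    _ = φ x * g₀ * ((hunit.unit⁻¹ : (Matrix ι ι L)ˣ) : Matrix ι ι L) := by rw [← mul_assoc, hg]
    _ = _ := by rw [hx, hg]

/-- The same, in the form `φ(x) · g = g · x^L` (no inverse). [folklore] -/
theorem exists_algHom_apply_mul_eq (φ : Matrix ι ι K →ₐ[K] Matrix ι ι L) :
    ∃ g : GL ι L, ∀ x : Matrix ι ι K,
      φ x * (g : Matrix ι ι L) = (g : Matrix ι ι L) * x.map (algebraMap K L) := by
  obtain ⟨g, hg⟩ := exists_algHom_apply_eq_conj φ
  refine ⟨g, fun x => ?_⟩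
  rw [hg x, mul_assoc, Units.inv_mul, mul_one]

end Literature.LinearAlgebra.Matrix
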